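import Summits.MatrixMultiplication.OmegaCensus.STPP222PentaOrder72

/-!
# STPP families lift along surjections: feasibility passes from a quotient to the group

Cell `pub-omega`, STPP track (family b′), seat pub-omega-stpp-2 (gen 6). HONEST FRAMING: lottery ticket; floor =
certified bounds/negative ranges. This file proves NOTHING about `ω`; it records the second transport rule of the finite
STPP census (the first, transport along INJECTIVE homomorphisms, is the tree's `IsSTPP.image`):

* `IsSTPP.image_section` — if `q : G →+ Q` has a set-theoretic section `s` (`q (s x) = x`) and `(Aᵢ, Bᵢ, Cᵢ)` is an STPP
  family in `Q`, then `(s(Aᵢ), s(Bᵢ), s(Cᵢ))` is an STPP family in `G`: apply `q` to the defining word.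
* `exists_isSTPP_of_surjective` — hence a size pattern realised in a QUOTIENT `Q` of `G` (any surjective additive hom
  `G → Q`) is realised in `G` with the same cardinalities; census reading: 'INFEASIBLE in `G` ⇒ INFEASIBLE in every quotient
  of `G`' and 'FEASIBLE in a quotient ⇒ FEASIBLE in `G`' (for finite abelian groups quotients and subgroups have the same
  isomorphism types, so together with `IsSTPP.image` either direction of transport is available from whichever map is at hand).
* `exists_isSTPP_222pow_of_surjective`, `exists_isSTPP_222tetra_prod_seed_2_2_2_7` — the `(2,2,2)^N` packaging and one
  instance: `(2,2,2)⁴ ⊆ (ℤ/2 × ℤ/2 × ℤ/2 × ℤ/7) × K` for every abelian group `K` (projection onto the order-56 seed of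
  `STPP222PentaOrder72.lean`).

References: H. Cohn, R. Kleinberg, B. Szegedy, C. Umans, FOCS 2005 (arXiv:math/0511460), Def. 5.1.
-/

open Literature.Computability.AlgebraicComplexity Finset

namespace Summit.MatrixMultiplication.OmegaCensus

variable {G Q : Type*} [AddCommGroup G] [AddCommGroup Q] {N : ℕ}

/-- **STPP families lift along a section of an additive surjection.** If `q (s x) = x` for all `x` and `(A, B, C)` is an
STPP family in `Q`, the images under `s` form an STPP family in `G`: the defining word in `G` maps under `q` to the
defining word in `Q`. [cite: CohnKleinbergSzegedyUmans2005, Def. 5.1] -/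
theorem _root_.Literature.Computability.AlgebraicComplexity.IsSTPP.image_section [DecidableEq G] (q : G →+ Q)
    (s : Q → G) (hs : ∀ x, q (s x) = x) {A B C : Fin N → Finset Q} (h : IsSTPP A B C) :
    IsSTPP (fun i => (A i).image s) (fun i => (B i).image s) (fun i => (C i).image s) := by
  intro i j k a ha a' ha' b hb b' hb' c hc c' hc' heq
  simp only [Finset.mem_image] at ha ha' hb hb' hc hc'
  obtain ⟨a, ha, rfl⟩ := ha
  obtain ⟨a', ha', rfl⟩ := ha'
  obtain ⟨b, hb, rfl⟩ := hb
  obtain ⟨b', hb', rfl⟩ := hb'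
  obtain ⟨c, hc, rfl⟩ := hc
  obtain ⟨c', hc', rfl⟩ := hc'
  have heq' : (a' - a) + (b' - b) + (c' - c) = 0 := by
    have := congrArg q heq
    simpa only [map_add, map_sub, map_zero, hs] using this
  obtain ⟨hij, hjk, haa, hbb, hcc⟩ := h i j k a ha a' ha' b hb b' hb' c hc c' hc' heq'
  exact ⟨hij, hjk, by rw [haa], by rw [hbb], by rw [hcc]⟩

/-- **A size pattern realised in a quotient is realised in the group**: along any surjective additive hom `q : G → Q`,
an STPP family in `Q` lifts (by a section) to an STPP family in `G` with the same cardinalities `|Aᵢ|, |Bᵢ|, |Cᵢ|`.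
[cite: CohnKleinbergSzegedyUmans2005, Def. 5.1] -/
theorem exists_isSTPP_of_surjective [DecidableEq G] (q : G →+ Q) (hq : Function.Surjective q)
    {A B C : Fin N → Finset Q} (h : IsSTPP A B C) :
    ∃ A' B' C' : Fin N → Finset G, IsSTPP A' B' C' ∧
      ∀ i, (A' i).card = (A i).card ∧ (B' i).card = (B i).card ∧ (C' i).card = (C i).card := by
  have hs : ∀ x, q (Function.surjInv hq x) = x := Function.surjInv_eq hq
  have hinj : Function.Injective (Function.surjInv hq) := Function.injective_surjInv hq
  exact ⟨_, _, _, h.image_section q _ hs, fun i =>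
    ⟨card_image_of_injective _ hinj, card_image_of_injective _ hinj, card_image_of_injective _ hinj⟩⟩

/-- The `(2,2,2)^N` packaging of `exists_isSTPP_of_surjective`. [cite: CohnKleinbergSzegedyUmans2005, Def. 5.1] -/
theorem exists_isSTPP_222pow_of_surjective [DecidableEq G] (q : G →+ Q) (hq : Function.Surjective q)
    (h : ∃ A B C : Fin N → Finset Q, IsSTPP A B C ∧ ∀ i, (A i).card = 2 ∧ (B i).card = 2 ∧ (C i).card = 2) :
    ∃ A B C : Fin N → Finset G, IsSTPP A B C ∧ ∀ i, (A i).card = 2 ∧ (B i).card = 2 ∧ (C i).card = 2 := by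
  obtain ⟨A, B, C, hS, hc⟩ := h
  obtain ⟨A', B', C', hS', hc'⟩ := exists_isSTPP_of_surjective q hq hS
  refine ⟨A', B', C', hS', fun i => ?_⟩
  obtain ⟨h1, h2, h3⟩ := hc' i
  obtain ⟨e1, e2, e3⟩ := hc i
  exact ⟨h1.trans e1, h2.trans e2, h3.trans e3⟩

/-- **Instance**: `(2,2,2)⁴ ⊆ (ℤ/2 × ℤ/2 × ℤ/2 × ℤ/7) × K` for every abelian group `K` — project onto the order-56 seed
`exists_isSTPP_222tetra_seed_2_2_2_7`. [cite: CohnKleinbergSzegedyUmans2005, Def. 5.1] -/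
theorem exists_isSTPP_222tetra_prod_seed_2_2_2_7 (K : Type*) [AddCommGroup K] [DecidableEq K] :
    ∃ A B C : Fin 4 → Finset ((ZMod 2 × ZMod 2 × ZMod 2 × ZMod 7) × K), IsSTPP A B C ∧
      ∀ i, (A i).card = 2 ∧ (B i).card = 2 ∧ (C i).card = 2 :=
  exists_isSTPP_222pow_of_surjective (AddMonoidHom.fst _ K) (fun x => ⟨(x, 0), rfl⟩)
    exists_isSTPP_222tetra_seed_2_2_2_7

section Injective

variable {K G : Type*} [AddCommGroup K] [AddCommGroup G] {N : ℕ}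

/-- **A size pattern realised in a subgroup is realised in the group** (general cardinalities; the injective
companion of `exists_isSTPP_of_surjective`, packaging the tree's `IsSTPP.image`): along any injective additive hom
`f : K → G`, an STPP family in `K` maps to one in `G` with the same `|Aᵢ|, |Bᵢ|, |Cᵢ|`.  Census reading: FEASIBLE in a
subgroup ⇒ FEASIBLE in the group; INFEASIBLE in `G` ⇒ INFEASIBLE in every subgroup. [cite: CohnKleinbergSzegedyUmans2005, Def. 5.1] -/
theorem exists_isSTPP_of_injective [DecidableEq G] (f : K →+ G) (hf : Function.Injective f)
    {A B C : Fin N → Finset K} (h : IsSTPP A B C) :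
    ∃ A' B' C' : Fin N → Finset G, IsSTPP A' B' C' ∧
      ∀ i, (A' i).card = (A i).card ∧ (B' i).card = (B i).card ∧ (C' i).card = (C i).card :=
  ⟨_, _, _, h.image f hf, fun _ =>
    ⟨card_image_of_injective _ hf, card_image_of_injective _ hf, card_image_of_injective _ hf⟩⟩

/-- Both transports at once for a finite pattern statement: if `K` embeds in `G` or `G` surjects onto `K`, every size
pattern `(aᵢ, bᵢ, cᵢ)` realised in `K` is realised in `G`. [cite: CohnKleinbergSzegedyUmans2005, Def. 5.1] -/
theorem exists_isSTPP_transport [DecidableEq G] {a b c : Fin N → ℕ}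
    (hK : ∃ A B C : Fin N → Finset K, IsSTPP A B C ∧ ∀ i, (A i).card = a i ∧ (B i).card = b i ∧ (C i).card = c i)
    (hmap : (∃ f : K →+ G, Function.Injective f) ∨ (∃ q : G →+ K, Function.Surjective q)) :
    ∃ A B C : Fin N → Finset G, IsSTPP A B C ∧ ∀ i, (A i).card = a i ∧ (B i).card = b i ∧ (C i).card = c i := by
  obtain ⟨A, B, C, hS, hc⟩ := hK
  rcases hmap with ⟨f, hf⟩ | ⟨q, hq⟩
  · obtain ⟨A', B', C', hS', hc'⟩ := exists_isSTPP_of_injective f hf hS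
    refine ⟨A', B', C', hS', fun i => ?_⟩
    obtain ⟨h1, h2, h3⟩ := hc' i; obtain ⟨e1, e2, e3⟩ := hc i
    exact ⟨h1.trans e1, h2.trans e2, h3.trans e3⟩
  · obtain ⟨A', B', C', hS', hc'⟩ := exists_isSTPP_of_surjective q hq hS
    refine ⟨A', B', C', hS', fun i => ?_⟩
    obtain ⟨h1, h2, h3⟩ := hc' i; obtain ⟨e1, e2, e3⟩ := hc i
    exact ⟨h1.trans e1, h2.trans e2, h3.trans e3⟩

end Injective

end Summit.MatrixMultiplication.OmegaCensus
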